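import Mathlib
import HarnessLib

/-!
# OutsiderSandwich — typed separating worlds for the one-block cut (decomp-mm lens-4, g18)

Route `route-MatrixMultiplication-OutsiderSandwich`.  The tree PROVES the chain of residuals

  `LaserMergeOptimal ⟹ CouplingMergeOptimal ⟹ BlockOneMergeOptimal`

(`Theorems/OutsiderSandwichSquaredLaserPacking.lean`, g18, hypothesis-free).  This route-independent
file shows that NEITHER converse follows from the single-point VALUE LAWS the tree knows for a
universal spectral point `F` at the five tensors in play — `m = F⟨2,2,2⟩`, `f = F(cw₂)`,
`c_k = F(C_k)` (`C₁, C₂, C₃` the coupled blocks of `cw₂ ⊗ cw₂`):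

* L1 `4 ≤ m ≤ 8` (`2 ≤ τ_F ≤ 3`);  L2 `3 ≤ f ≤ 4` (`Q̃(cw₂) = 3`, `R(cw₂) ≤ 4` over `ℂ`);
* L3 the LASER FLOOR `27 m ≤ 4 f³` (`f ≥ 3·2^{(τ−2)/3}`, item `LaserFloor`);
* L4 `4 ≤ c_k ≤ 7` (`Q̃(C_k) = 4`, `R(C₁) ≤ 7`);  L5 `c_k ≤ f²`;
* L6 the COUPLING BENCHMARK `4 m² ≤ c₁c₂c₃`;
* L7 the SQUARED LASER FLOOR `3¹⁸ m² (c₁c₂c₃)² ≤ 2¹⁶ f¹⁸` (item `SquaredLaserFloor`, g18);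
* L8 closure under leg rotation `(m, f, c₁, c₂, c₃) ↦ (m, f, c₃, c₁, c₂)`;
* L9 a point maximal in `m` exists (`τ = ω` is attained).

A WORLD is a set `X` of value tuples satisfying L1–L9 (`Laws X`); the route's letters read on a
world: `SummitW` (`m ≤ 4` everywhere, i.e. `ω = 2`), `BlockOneMergeOptimalW` (a top point with
`c₁ ≤ m`), `CouplingMergeOptimalW` (a top point with `c₁c₂c₃ ≤ 4m²`), `LaserTightAtTopW` (the
spectral form of `LaserMergeOptimal`: near-top points on the laser floor line).  The companion file
`OutsiderSandwichBlockOneWorldsFaithful.lean` proves that the TRUE value set satisfies `Laws` and that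
the four letters there are literally the route items.

Results (pure real arithmetic):
* `worldOne` — `X₁ = {(5, 31/8, 4,7,7) + rotations, (4, 3, 4,4,4)}`: `Laws`, `BlockOneMergeOptimalW`,
  `¬ CouplingMergeOptimalW`, `¬ LaserTightAtTopW`, `¬ SummitW`.  So `BlockOneMergeOptimal ⟹
  CouplingMergeOptimal` (and `⟹ LaserMergeOptimal`, `⟹ ω = 2`) is NOT a consequence of L1–L9: the
  one-block residual is STRICTLY weaker than the coupling and laser residuals relative to the laws.
* `worldTwo` — `X₂ = {(5, 31/8, 4,5,5) + rotations, (4, 3, 4,4,4)}`: `Laws`, `CouplingMergeOptimalW`,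
  `¬ LaserTightAtTopW`, `¬ SummitW`: the coupling residual is strictly weaker than the laser residual.
* `worldZero` — `X₀ = {(4, 3, 4,4,4)}` (the `ω = 2` world, every law TIGHT): `Laws`, `SummitW` and all
  three merge-optimality letters — the laws are consistent with the summit.

References: [Strassen1988, Thm. 3.8]; [CoppersmithWinograd1990, §7]; [ConnerHuangLandsberg2020, §1];
[BurgisserClausenShokrollahi1997, Thm. 15.41].
-/

noncomputable section

namespace Summit.MatrixMultiplication.MatrixMultiplication.Theorems.OutsiderSandwichBlockOneWorlds

/-! ## 1. Value tuples, laws, letters -/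

/-- A value tuple `(m, f, c₁, c₂, c₃) = (F⟨2,2,2⟩, F(cw₂), F(C₁), F(C₂), F(C₃))`. -/
structure Pt where
  /-- `F⟨2,2,2⟩ = 2^{τ_F}` -/
  m : ℝ
  /-- `F(cw₂)` -/
  f : ℝ
  /-- `F(C₁)` -/
  c₁ : ℝ
  /-- `F(C₂)` -/
  c₂ : ℝ
  /-- `F(C₃)` -/
  c₃ : ℝ

/-- Leg rotation of a value tuple: `F ↦ F_C` maps `(c₁, c₂, c₃) ↦ (c₃, c₁, c₂)`. -/
def Pt.rot (v : Pt) : Pt := ⟨v.m, v.f, v.c₃, v.c₁, v.c₂⟩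

/-- **The laws L1–L9** of a world `X` (each the shadow of a tree theorem, see the Faithful file). -/
structure Laws (X : Set Pt) : Prop where
  /-- L1: `4 ≤ m ≤ 8`. -/
  m_mem : ∀ v ∈ X, 4 ≤ v.m ∧ v.m ≤ 8
  /-- L2: `3 ≤ f ≤ 4`. -/
  f_mem : ∀ v ∈ X, 3 ≤ v.f ∧ v.f ≤ 4
  /-- L3: laser floor `27 m ≤ 4 f³`. -/
  laser_floor : ∀ v ∈ X, 27 * v.m ≤ 4 * v.f ^ 3
  /-- L4: `4 ≤ c_k ≤ 7`. -/
  c_mem : ∀ v ∈ X, (4 ≤ v.c₁ ∧ v.c₁ ≤ 7) ∧ (4 ≤ v.c₂ ∧ v.c₂ ≤ 7) ∧ (4 ≤ v.c₃ ∧ v.c₃ ≤ 7)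
  /-- L5: `c_k ≤ f²`. -/
  c_le_sq : ∀ v ∈ X, v.c₁ ≤ v.f ^ 2 ∧ v.c₂ ≤ v.f ^ 2 ∧ v.c₃ ≤ v.f ^ 2
  /-- L6: coupling benchmark `4 m² ≤ c₁ c₂ c₃`. -/
  benchmark : ∀ v ∈ X, 4 * v.m ^ 2 ≤ v.c₁ * v.c₂ * v.c₃
  /-- L7: squared laser floor `3¹⁸ m² (c₁c₂c₃)² ≤ 2¹⁶ f¹⁸`. -/
  squared_floor : ∀ v ∈ X, 3 ^ 18 * v.m ^ 2 * (v.c₁ * v.c₂ * v.c₃) ^ 2 ≤ 2 ^ 16 * v.f ^ 18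
  /-- L8: closure under leg rotation. -/
  rot_mem : ∀ v ∈ X, v.rot ∈ X
  /-- L9: a point maximal in `m` exists. -/
  top_exists : ∃ v ∈ X, ∀ w ∈ X, w.m ≤ v.m

/-- A top point of a world: maximal `m` (`τ_F = ω`). -/
def IsTop (X : Set Pt) (v : Pt) : Prop := v ∈ X ∧ ∀ w ∈ X, w.m ≤ v.m

/-- The summit read on a world: `m ≤ 4` everywhere (`ω = 2`). -/
def SummitW (X : Set Pt) : Prop := ∀ v ∈ X, v.m ≤ 4

/-- `BlockOneMergeOptimal` read on a world: a top point with `F(C₁) ≤ F⟨2,2,2⟩`. -/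
def BlockOneMergeOptimalW (X : Set Pt) : Prop := ∃ v, IsTop X v ∧ v.c₁ ≤ v.m

/-- `CouplingMergeOptimal` read on a world: a top point with `F(C) ≤ 4 F⟨2,2,2⟩²`. -/
def CouplingMergeOptimalW (X : Set Pt) : Prop := ∃ v, IsTop X v ∧ v.c₁ * v.c₂ * v.c₃ ≤ 4 * v.m ^ 2

/-- `LaserTightAtTop` (`⟺ LaserMergeOptimal`) read on a world: for every `δ > 0` a `δ`-near-top
point `δ`-close to the laser floor line `log₂ f = log₂ 3 + (τ − 2)/3`. -/
def LaserTightAtTopW (X : Set Pt) : Prop :=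
  ∀ δ : ℝ, 0 < δ → ∃ v ∈ X, (∀ w ∈ X, Real.logb 2 w.m ≤ Real.logb 2 v.m + δ) ∧
    Real.logb 2 v.f ≤ Real.logb 2 3 + (Real.logb 2 v.m - 2) / 3 + δ

/-! ## 2. Rational bounds on binary logarithms -/

/-- `x^q < 2^p ⟹ log₂ x < p/q`. -/
theorem logb_two_lt {x : ℝ} (hx : 0 < x) {p q : ℕ} (hq : 0 < q) (h : x ^ q < (2 : ℝ) ^ p) :
    Real.logb 2 x < (p : ℝ) / q := by
  have hlog2 : 0 < Real.log 2 := Real.log_pos one_lt_two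
  have hq' : (0 : ℝ) < q := by exact_mod_cast hq
  have h1 : (q : ℝ) * Real.log x < (p : ℝ) * Real.log 2 := by
    rw [← Real.log_pow, ← Real.log_pow]; exact Real.log_lt_log (pow_pos hx q) h
  rw [Real.logb, div_lt_iff₀ hlog2]
  have h2 : Real.log x < (p : ℝ) * Real.log 2 / q := by rw [lt_div_iff₀ hq']; linarith
  calc Real.log x < (p : ℝ) * Real.log 2 / q := h2
    _ = (p : ℝ) / q * Real.log 2 := by ring

/-- `2^p < x^q ⟹ p/q < log₂ x`. -/
theorem lt_logb_two {x : ℝ} {p q : ℕ} (hq : 0 < q) (h : (2 : ℝ) ^ p < x ^ q) :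
    (p : ℝ) / q < Real.logb 2 x := by
  have hlog2 : 0 < Real.log 2 := Real.log_pos one_lt_two
  have hq' : (0 : ℝ) < q := by exact_mod_cast hq
  have h1 : (p : ℝ) * Real.log 2 < (q : ℝ) * Real.log x := by
    rw [← Real.log_pow, ← Real.log_pow]; exact Real.log_lt_log (pow_pos two_pos p) h
  rw [Real.logb, lt_div_iff₀ hlog2]
  have h2 : (p : ℝ) * Real.log 2 / q < Real.log x := by rw [div_lt_iff₀ hq']; linarith
  calc (p : ℝ) / q * Real.log 2 = (p : ℝ) * Real.log 2 / q := by ring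
    _ < Real.log x := h2

/-- `log₂ 3 < 8/5` (`3⁵ = 243 < 256 = 2⁸`). -/
theorem logb_two_three_lt : Real.logb 2 3 < 8 / 5 := by
  have h := logb_two_lt (x := 3) (by norm_num) (p := 8) (q := 5) (by norm_num) (by norm_num)
  norm_num at h; exact h

/-- `log₂ 5 < 7/3` (`5³ = 125 < 128 = 2⁷`). -/
theorem logb_two_five_lt : Real.logb 2 5 < 7 / 3 := by
  have h := logb_two_lt (x := 5) (by norm_num) (p := 7) (q := 3) (by norm_num) (by norm_num)
  norm_num at h; exact h

/-- `23/10 < log₂ 5` (`2²³ < 5¹⁰`). -/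
theorem lt_logb_two_five : 23 / 10 < Real.logb 2 5 := by
  have h := lt_logb_two (x := 5) (p := 23) (q := 10) (by norm_num) (by norm_num)
  norm_num at h; exact h

/-- `log₂ 4 < 21/10` (`4¹⁰ < 2²¹`). -/
theorem logb_two_four_lt : Real.logb 2 4 < 21 / 10 := by
  have h := logb_two_lt (x := 4) (by norm_num) (p := 21) (q := 10) (by norm_num) (by norm_num)
  norm_num at h; exact h

/-- `19/10 < log₂ (31/8)` (`2¹⁹ < (31/8)¹⁰`). -/
theorem lt_logb_two_f : 19 / 10 < Real.logb 2 (31 / 8) := by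
  have h := lt_logb_two (x := 31 / 8) (p := 19) (q := 10) (by norm_num) (by norm_num)
  norm_num at h; exact h

/-- At a top point `(m, f) = (5, 31/8)` the laser floor line is missed by more than `1/10`. -/
theorem top_off_floor : ¬ Real.logb 2 (31 / 8) ≤ Real.logb 2 3 + (Real.logb 2 5 - 2) / 3 + 1 / 10 := by
  have h3 := logb_two_three_lt
  have h5 := logb_two_five_lt
  have hf := lt_logb_two_f
  intro h; linarith

/-- The bottom point `m = 4` is not `1/10`-near the top `m = 5`. -/
theorem bottom_not_near : ¬ Real.logb 2 5 ≤ Real.logb 2 4 + 1 / 10 := by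
  have h4 := logb_two_four_lt
  have h5 := lt_logb_two_five
  intro h; linarith

/-! ## 3. World one: `BlockOneMergeOptimal ∧ ¬CouplingMergeOptimal ∧ ¬LaserMergeOptimal ∧ ω > 2` -/

/-- Top point of world one: `τ = log₂ 5`, `f = 31/8`, `(c₁,c₂,c₃) = (4,7,7)`. -/
def T₁ : Pt := ⟨5, 31 / 8, 4, 7, 7⟩
/-- Its rotation `(7,4,7)`. -/
def T₂ : Pt := ⟨5, 31 / 8, 7, 4, 7⟩
/-- Its second rotation `(7,7,4)`. -/
def T₃ : Pt := ⟨5, 31 / 8, 7, 7, 4⟩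
/-- The gauge corner `τ = 2`: `(4, 3, 4, 4, 4)` (the values of the support functionals). -/
def B₀ : Pt := ⟨4, 3, 4, 4, 4⟩

/-- World one. -/
def X₁ : Set Pt := {v | v = T₁ ∨ v = T₂ ∨ v = T₃ ∨ v = B₀}

/-- World one satisfies the laws. -/
theorem laws_X₁ : Laws X₁ where
  m_mem := by rintro v (rfl | rfl | rfl | rfl) <;> norm_num [T₁, T₂, T₃, B₀]
  f_mem := by rintro v (rfl | rfl | rfl | rfl) <;> norm_num [T₁, T₂, T₃, B₀]
  laser_floor := by rintro v (rfl | rfl | rfl | rfl) <;> norm_num [T₁, T₂, T₃, B₀]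
  c_mem := by rintro v (rfl | rfl | rfl | rfl) <;> norm_num [T₁, T₂, T₃, B₀]
  c_le_sq := by rintro v (rfl | rfl | rfl | rfl) <;> norm_num [T₁, T₂, T₃, B₀]
  benchmark := by rintro v (rfl | rfl | rfl | rfl) <;> norm_num [T₁, T₂, T₃, B₀]
  squared_floor := by rintro v (rfl | rfl | rfl | rfl) <;> norm_num [T₁, T₂, T₃, B₀]
  rot_mem := by
    rintro v (rfl | rfl | rfl | rfl)
    · exact Or.inr (Or.inl rfl)
    · exact Or.inr (Or.inr (Or.inl rfl))
    · exact Or.inl rfl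
    · exact Or.inr (Or.inr (Or.inr rfl))
  top_exists := ⟨T₁, Or.inl rfl, by rintro w (rfl | rfl | rfl | rfl) <;> norm_num [T₁, T₂, T₃, B₀]⟩

/-- `T₁` is a top point of world one. -/
theorem isTop_T₁ : IsTop X₁ T₁ :=
  ⟨Or.inl rfl, by rintro w (rfl | rfl | rfl | rfl) <;> norm_num [T₁, T₂, T₃, B₀]⟩

/-- In world one `BlockOneMergeOptimal` holds (`c₁ = 4 ≤ 5 = m` at the top point `T₁`). -/
theorem blockOneMergeOptimalW_X₁ : BlockOneMergeOptimalW X₁ :=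
  ⟨T₁, isTop_T₁, by norm_num [T₁]⟩

/-- In world one `CouplingMergeOptimal` fails (`c₁c₂c₃ = 196 > 100 = 4m²` at every top point). -/
theorem not_couplingMergeOptimalW_X₁ : ¬ CouplingMergeOptimalW X₁ := by
  rintro ⟨v, ⟨hv, htop⟩, hle⟩
  rcases hv with rfl | rfl | rfl | rfl
  · norm_num [T₁] at hle
  · norm_num [T₂] at hle
  · norm_num [T₃] at hle
  · have h := htop T₁ (Or.inl rfl); norm_num [T₁, B₀] at h

/-- In world one `LaserTightAtTop` (`⟺ LaserMergeOptimal`) fails: with `δ = 1/10` the top points miss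
the floor line and the bottom point is not near the top. -/
theorem not_laserTightAtTopW_X₁ : ¬ LaserTightAtTopW X₁ := by
  intro h
  obtain ⟨v, hv, hnear, hfloor⟩ := h (1 / 10) (by norm_num)
  rcases hv with rfl | rfl | rfl | rfl
  · exact top_off_floor (by simpa [T₁] using hfloor)
  · exact top_off_floor (by simpa [T₂] using hfloor)
  · exact top_off_floor (by simpa [T₃] using hfloor)
  · exact bottom_not_near (by simpa [T₁, B₀] using hnear T₁ (Or.inl rfl))

/-- In world one the summit fails (`m = 5 > 4` at the top). -/
theorem not_summitW_X₁ : ¬ SummitW X₁ := fun h => by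
  have := h T₁ (Or.inl rfl); norm_num [T₁] at this

/-- **World one**: the laws L1–L9 together with `BlockOneMergeOptimal` do NOT yield
`CouplingMergeOptimal`, `LaserMergeOptimal` (as `LaserTightAtTop`) or `ω = 2`. -/
theorem worldOne : ∃ X : Set Pt, Laws X ∧ BlockOneMergeOptimalW X ∧ ¬ CouplingMergeOptimalW X ∧
    ¬ LaserTightAtTopW X ∧ ¬ SummitW X :=
  ⟨X₁, laws_X₁, blockOneMergeOptimalW_X₁, not_couplingMergeOptimalW_X₁, not_laserTightAtTopW_X₁,
    not_summitW_X₁⟩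

/-! ## 4. World two: `CouplingMergeOptimal ∧ ¬LaserMergeOptimal ∧ ω > 2` -/

/-- Top point of world two: `(c₁,c₂,c₃) = (4,5,5)`, `c₁c₂c₃ = 100 = 4m²`. -/
def U₁ : Pt := ⟨5, 31 / 8, 4, 5, 5⟩
/-- Its rotation. -/
def U₂ : Pt := ⟨5, 31 / 8, 5, 4, 5⟩
/-- Its second rotation. -/
def U₃ : Pt := ⟨5, 31 / 8, 5, 5, 4⟩

/-- World two. -/
def X₂ : Set Pt := {v | v = U₁ ∨ v = U₂ ∨ v = U₃ ∨ v = B₀}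

/-- World two satisfies the laws. -/
theorem laws_X₂ : Laws X₂ where
  m_mem := by rintro v (rfl | rfl | rfl | rfl) <;> norm_num [U₁, U₂, U₃, B₀]
  f_mem := by rintro v (rfl | rfl | rfl | rfl) <;> norm_num [U₁, U₂, U₃, B₀]
  laser_floor := by rintro v (rfl | rfl | rfl | rfl) <;> norm_num [U₁, U₂, U₃, B₀]
  c_mem := by rintro v (rfl | rfl | rfl | rfl) <;> norm_num [U₁, U₂, U₃, B₀]
  c_le_sq := by rintro v (rfl | rfl | rfl | rfl) <;> norm_num [U₁, U₂, U₃, B₀]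
  benchmark := by rintro v (rfl | rfl | rfl | rfl) <;> norm_num [U₁, U₂, U₃, B₀]
  squared_floor := by rintro v (rfl | rfl | rfl | rfl) <;> norm_num [U₁, U₂, U₃, B₀]
  rot_mem := by
    rintro v (rfl | rfl | rfl | rfl)
    · exact Or.inr (Or.inl rfl)
    · exact Or.inr (Or.inr (Or.inl rfl))
    · exact Or.inl rfl
    · exact Or.inr (Or.inr (Or.inr rfl))
  top_exists := ⟨U₁, Or.inl rfl, by rintro w (rfl | rfl | rfl | rfl) <;> norm_num [U₁, U₂, U₃, B₀]⟩

/-- In world two `CouplingMergeOptimal` holds (`c₁c₂c₃ = 100 = 4m²` at the top point `U₁`). -/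
theorem couplingMergeOptimalW_X₂ : CouplingMergeOptimalW X₂ :=
  ⟨U₁, ⟨Or.inl rfl, by rintro w (rfl | rfl | rfl | rfl) <;> norm_num [U₁, U₂, U₃, B₀]⟩,
    by norm_num [U₁]⟩

/-- In world two `LaserTightAtTop` fails. -/
theorem not_laserTightAtTopW_X₂ : ¬ LaserTightAtTopW X₂ := by
  intro h
  obtain ⟨v, hv, hnear, hfloor⟩ := h (1 / 10) (by norm_num)
  rcases hv with rfl | rfl | rfl | rfl
  · exact top_off_floor (by simpa [U₁] using hfloor)
  · exact top_off_floor (by simpa [U₂] using hfloor)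
  · exact top_off_floor (by simpa [U₃] using hfloor)
  · exact bottom_not_near (by simpa [U₁, B₀] using hnear U₁ (Or.inl rfl))

/-- In world two the summit fails. -/
theorem not_summitW_X₂ : ¬ SummitW X₂ := fun h => by
  have := h U₁ (Or.inl rfl); norm_num [U₁] at this

/-- **World two**: the laws L1–L9 together with `CouplingMergeOptimal` do NOT yield `LaserMergeOptimal`
(as `LaserTightAtTop`) or `ω = 2`. -/
theorem worldTwo : ∃ X : Set Pt, Laws X ∧ CouplingMergeOptimalW X ∧ ¬ LaserTightAtTopW X ∧
    ¬ SummitW X :=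
  ⟨X₂, laws_X₂, couplingMergeOptimalW_X₂, not_laserTightAtTopW_X₂, not_summitW_X₂⟩

/-! ## 5. World zero: the `ω = 2` world, every law tight -/

/-- World zero: the single gauge corner. -/
def X₀ : Set Pt := {v | v = B₀}

/-- World zero satisfies the laws — L3, L6, L7 with EQUALITY. -/
theorem laws_X₀ : Laws X₀ where
  m_mem := by rintro v rfl; norm_num [B₀]
  f_mem := by rintro v rfl; norm_num [B₀]
  laser_floor := by rintro v rfl; norm_num [B₀]
  c_mem := by rintro v rfl; norm_num [B₀]
  c_le_sq := by rintro v rfl; norm_num [B₀]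
  benchmark := by rintro v rfl; norm_num [B₀]
  squared_floor := by rintro v rfl; norm_num [B₀]
  rot_mem := by rintro v rfl; rfl
  top_exists := ⟨B₀, rfl, by rintro w rfl; exact le_rfl⟩

/-- In world zero the summit and all three merge-optimality letters hold. -/
theorem worldZero : Laws X₀ ∧ SummitW X₀ ∧ BlockOneMergeOptimalW X₀ ∧ CouplingMergeOptimalW X₀ ∧
    LaserTightAtTopW X₀ := by
  refine ⟨laws_X₀, ?_, ⟨B₀, ⟨rfl, ?_⟩, by norm_num [B₀]⟩, ⟨B₀, ⟨rfl, ?_⟩, by norm_num [B₀]⟩, ?_⟩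
  · rintro v rfl; norm_num [B₀]
  · rintro w rfl; exact le_rfl
  · rintro w rfl; exact le_rfl
  · intro δ hδ
    refine ⟨B₀, rfl, ?_, ?_⟩
    · rintro w rfl; linarith
    · have h4 : Real.logb 2 (4 : ℝ) = 2 := by
        rw [show (4 : ℝ) = 2 ^ (2 : ℝ) by norm_num, Real.logb_rpow two_pos (by norm_num)]
      simp only [B₀, h4]
      linarith

end Summit.MatrixMultiplication.MatrixMultiplication.Theorems.OutsiderSandwichBlockOneWorlds
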